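import Summits.AtomisticToContinuum.FouriersLaw.Theorems.LocalEnergyHalfHoelder.Negative.FalseWithoutGibbs
import Literature.MathematicalPhysics.KineticTheory.InfiniteChainAbelWitness

/-!
# `LocalEnergyHalfHoelder` (stmt-AtomisticToContinuum-16008): `PreservesMeasure` is load-bearing,
# given any Gibbs state with square-integrable site energy

Negative lemma (refuter / crux disprover, load-bearing analysis, 2026-08-17), companion of
`FalseWithoutGibbs.lean`. Drop the ONE guard `D.PreservesMeasure μ` from
`HoelderEscapeProfile.LocalEnergyHalfHoelder` (everything else verbatim): then the FROZEN dynamics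
(`OscillatorChain.restDynamics`: carrier `{rest}`, `φ_t = id`, an honest `InfiniteChainDynamics` of
every pinned chain since `U'(0) = 0`) is admissible — it commutes with the shift trivially — and in
ANY Gibbs state `μ` with `h_0 ∈ L²(μ)` it gives `S(0,t) ≡ Var_μ(h_0) > 0` (an atom at frequency 0),
contradicting `Ψ(ν) ≤ C√ν`. Positivity of the variance is the only work: under DLR the level sets
`{h_0 = c}` are `μ`-null (`gibbs_siteE_level_null`), because given the outside configuration `h_0`
is `p²/2 + W(q)` and `{p²/2 + W(q) = c}` is the union of two graphs, Lebesgue-null in `ℝ²`.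

The statement is CONDITIONAL on the existence of such a Gibbs state (shift- and reversal-invariant,
`h_0 ∈ L²`) — the first half of the route's de-vacuifier crux `SymmetricSetup` (stmt-11036) plus a
moment bound; it is not constructed in the tree, so the lemma is filed as
`…_of_gibbsState : (∃ μ, …) → ¬ (K1 without PreservesMeasure)`. No statement of the route is asserted.
-/

noncomputable section

open MeasureTheory Filter Set
open scoped ENNReal

namespace Summit.AtomisticToContinuum.FouriersLaw.Theorems.LocalEnergyHalfHoelder.Negative.FalseWithoutPreservesMeasure

open Literature.MathematicalPhysics.KineticTheory.HeatConduction
open Literature.Probability.LatticeModels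
open Summit.AtomisticToContinuum.FouriersLaw.Theorems.LocalEnergyHalfHoelder.Negative.FalseWithoutGibbs
open Summit.AtomisticToContinuum.FouriersLaw.Theorems.LocalEnergyHalfHoelder.Negative

/-- A level set of `(q, p) ↦ p²/2 + W(q)` (`W` continuous) is Lebesgue-null in `ℝ × ℝ`: it lies on
the two graphs `p = ±√(2(c - W q))`. [folklore] -/
theorem volume_level_kinetic_add_eq_zero {W : ℝ → ℝ} (hW : Continuous W) (c : ℝ) :
    volume {x : ℝ × ℝ | x.2 ^ 2 / 2 + W x.1 = c} = 0 := by
  set g : ℝ → ℝ := fun q => Real.sqrt (2 * (c - W q)) with hg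
  have hgc : Continuous g := (continuous_const.mul (continuous_const.sub hW)).sqrt
  have hsub : {x : ℝ × ℝ | x.2 ^ 2 / 2 + W x.1 = c} ⊆ {x | x.2 = g x.1} ∪ {x | x.2 = -g x.1} := by
    rintro ⟨q, p⟩ hx
    simp only [mem_setOf_eq] at hx
    have h2 : p ^ 2 = 2 * (c - W q) := by linarith
    have habs : |p| = g q := by
      show |p| = Real.sqrt (2 * (c - W q))
      rw [← h2, Real.sqrt_sq_eq_abs]
    rcases abs_eq (Real.sqrt_nonneg (2 * (c - W q))) |>.mp habs with h | h
    · exact Or.inl h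
    · exact Or.inr h
  refine measure_mono_null hsub (measure_union_null ?_ ?_)
  · have hm : MeasurableSet {x : ℝ × ℝ | x.2 = g x.1} :=
      measurableSet_eq_fun measurable_snd (hgc.measurable.comp measurable_fst)
    rw [Measure.volume_eq_prod, Measure.measure_prod_null hm]
    exact Eventually.of_forall fun q => by
      have : (Prod.mk q ⁻¹' {x : ℝ × ℝ | x.2 = g x.1}) = {g q} := by ext p; simp
      simp [this]
  · have hm : MeasurableSet {x : ℝ × ℝ | x.2 = -g x.1} :=
      measurableSet_eq_fun measurable_snd (hgc.measurable.comp measurable_fst).neg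
    rw [Measure.volume_eq_prod, Measure.measure_prod_null hm]
    exact Eventually.of_forall fun q => by
      have : (Prod.mk q ⁻¹' {x : ℝ × ℝ | x.2 = -g x.1}) = {-g q} := by ext p; simp
      simp [this]

variable {ω₂ lam : ℝ}

/-- **Level sets of the site energy are null under any DLR state of the pinned chain.** [folklore] -/
theorem gibbs_siteE_level_null (β γ T : ℝ) {μ : Measure ChainConfig}
    (hGibbs : (pinnedChain ω₂ lam β γ).IsChainGibbsMeasure T μ) (c : ℝ) :
    μ {σ | siteE ω₂ lam β γ σ 0 = c} = 0 := by
  classical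
  set P := pinnedChain ω₂ lam β γ with hP
  set A : Set ChainConfig := {σ | siteE ω₂ lam β γ σ 0 = c} with hAdef
  have hA : MeasurableSet A := measurableSet_eq_fun (measurable_siteE_zero β γ) measurable_const
  have hDLR := hGibbs.2 ({0} : Finset ℤ) A hA
  have h0 : (0:ℤ) ∈ ({0} : Finset ℤ) := Finset.mem_singleton_self 0
  have h1 : (0:ℤ) + 1 ∉ ({0} : Finset ℤ) := by decide
  have hm1 : (0:ℤ) - 1 ∉ ({0} : Finset ℤ) := by decide
  have hV : Continuous P.V := continuous_pinnedChain_V β γ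
  have hU : Continuous P.U := by
    rw [hP, UniformOscillationArena.pinnedChain_U]; exact UniformOscillationFlow.continuous_Upin ω₂ lam
  have hzero : ∀ η : ChainConfig, P.chainSpecification T {0} η A = 0 := by
    intro η
    set W : ℝ → ℝ := fun q => P.U q + (P.V ((η (0 + 1)).1 - q) + P.V (q - (η (0 - 1)).1)) / 2 with hW
    have hWc : Continuous W := by
      exact (hU.comp continuous_id).add (((hV.comp (continuous_const.sub continuous_id)).add
        (hV.comp (continuous_id.sub continuous_const))).div_const 2)
    show gibbsSpecOfPotential _ _ _ _ {0} η A = 0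
    unfold gibbsSpecOfPotential
    refine (tilted_absolutelyContinuous _ _) ?_
    rw [Measure.map_apply (measurable_glueWith _ η) hA]
    have hpre : (fun ζ : (↥({0} : Finset ℤ)) → ℝ × ℝ => glueWith ({0} : Finset ℤ) ζ η) ⁻¹' A
        ⊆ Function.eval (⟨0, h0⟩ : ↥({0} : Finset ℤ)) ⁻¹' {x : ℝ × ℝ | x.2 ^ 2 / 2 + W x.1 = c} := by
      intro ζ hζ
      simp only [mem_preimage, hAdef, mem_setOf_eq, siteE] at hζ
      rw [glueWith_apply_mem _ _ _ h0, glueWith_apply_not_mem _ _ _ h1,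
        glueWith_apply_not_mem _ _ _ hm1] at hζ
      simp only [mem_preimage, Function.eval, mem_setOf_eq, hW]
      linarith
    refine measure_mono_null hpre ?_
    exact Measure.pi_eval_preimage_null _ (volume_level_kinetic_add_eq_zero hWc c)
  simp only [hzero, lintegral_zero] at hDLR
  exact hDLR.symm

/-- In a DLR state with `h_0 ∈ L²` the site-energy variance is positive. [folklore] -/
theorem siteE_variance_pos (β γ T : ℝ) {μ : Measure ChainConfig}
    (hGibbs : (pinnedChain ω₂ lam β γ).IsChainGibbsMeasure T μ)
    (hL2 : MemLp (fun σ : ChainConfig => siteE ω₂ lam β γ σ 0) 2 μ) (m : ℝ) :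
    0 < ∫ σ, (siteE ω₂ lam β γ σ 0 - m) ^ 2 ∂μ := by
  haveI := hGibbs.isProbabilityMeasure
  have hint : Integrable (fun σ : ChainConfig => (siteE ω₂ lam β γ σ 0 - m) ^ 2) μ :=
    (hL2.sub (memLp_const m)).integrable_sq
  rw [integral_pos_iff_support_of_nonneg_ae (Eventually.of_forall fun σ => sq_nonneg _) hint]
  have hsupp : Function.support (fun σ : ChainConfig => (siteE ω₂ lam β γ σ 0 - m) ^ 2) =
      {σ | siteE ω₂ lam β γ σ 0 = m}ᶜ := by
    ext σ; simp [sub_eq_zero]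
  have hA : MeasurableSet {σ : ChainConfig | siteE ω₂ lam β γ σ 0 = m} :=
    measurableSet_eq_fun (measurable_siteE_zero β γ) measurable_const
  rw [hsupp, prob_compl_eq_one_sub hA, gibbs_siteE_level_null β γ T hGibbs m, tsub_zero]
  exact one_pos

/-- **`PreservesMeasure` is load-bearing, given a Gibbs state.** The displayed statement is
`HoelderEscapeProfile.LocalEnergyHalfHoelder` VERBATIM except that the guard `D.PreservesMeasure μ`
is DROPPED; it is false as soon as `pinnedChain 1 1 1 0` admits at `T = 1` a shift- and
reversal-invariant DLR state with square-integrable site energy (hypothesis; = the `μ`-half of crux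
`SymmetricSetup` plus a moment bound, not constructed in the tree): the frozen `restDynamics` is then
an admissible `D` with `S(0,t) ≡ Var_μ(h_0) > 0`. [folklore] -/
theorem localEnergyHalfHoelder_false_without_preservesMeasure_of_gibbsState
    (hex : ∃ μ : Measure ChainConfig, (pinnedChain 1 1 1 0).IsChainGibbsMeasure 1 μ ∧
      IsShiftInvariant μ ∧
      μ.map (fun σ : ChainConfig => fun x : ℤ => ((σ x).1, -(σ x).2)) = μ ∧
      MemLp (fun σ : ChainConfig => siteE 1 1 1 0 σ 0) 2 μ) :
    ¬ (∀ ω₂ lam β γ : ℝ, 0 < ω₂ → 0 < lam → 0 < β → ∀ T : ℝ, 0 < T → ∀ μ : MeasureTheory.Measure Literature.MathematicalPhysics.KineticTheory.HeatConduction.ChainConfig, (Literature.MathematicalPhysics.KineticTheory.HeatConduction.pinnedChain ω₂ lam β γ).IsChainGibbsMeasure T μ → Literature.MathematicalPhysics.KineticTheory.HeatConduction.IsShiftInvariant μ → μ.map (fun σ : Literature.MathematicalPhysics.KineticTheory.HeatConduction.ChainConfig => fun x : ℤ => ((σ x).1, -(σ x).2)) = μ → ∀ D : Literature.MathematicalPhysics.KineticTheory.HeatConduction.InfiniteChainDynamics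 (Literature.MathematicalPhysics.KineticTheory.HeatConduction.pinnedChain ω₂ lam β γ), (∀ t : ℝ, ∀ᵐ σ ∂μ, D.flow t (Literature.MathematicalPhysics.KineticTheory.HeatConduction.shift σ) = Literature.MathematicalPhysics.KineticTheory.HeatConduction.shift (D.flow t σ)) → ∀ h : Literature.MathematicalPhysics.KineticTheory.HeatConduction.ChainConfig → ℤ → ℝ, h = (fun (σ : Literature.MathematicalPhysics.KineticTheory.HeatConduction.ChainConfig) (x : ℤ) => (σ x).2 ^ 2 / 2 + (Literature.MathematicalPhysics.KineticTheory.HeatConduction.pinnedChain ω₂ lam β γ).U (σ x).1 + ((Literature.MathematicalPhysics.KineticTheory.HeatConduction.pinnedChain ω₂ lam β γ).V ((σ (x + 1)).1 - (σ x).1) + (Literature.MathematicalPhysics.KineticTheory.HeatConduction.pinnedChain ω₂ lam β γ).V ((σ x).1 - (σ (x - 1)).1)) / 2) → ∀ S : ℤ → ℝ → ℝ, S = (fun (x : ℤ) (t : ℝ) => ∫ σ, (h σ 0 - ∫ σ', h σ' 0 ∂μ) * (h (D.flow t σ) x - ∫ σ', h σ' 0 ∂μ) ∂μ) → (∀ ν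 : ℝ, 0 < ν → MeasureTheory.IntegrableOn (fun t : ℝ => Real.exp (-(ν * t)) * S 0 t) (Set.Ioi 0)) → ∃ C ν₀ : ℝ, 0 < ν₀ ∧ ∀ ν : ℝ, 0 < ν → ν ≤ ν₀ → ν * ∫ t in Set.Ioi (0:ℝ), Real.exp (-(ν * t)) * S 0 t ≤ C * Real.sqrt ν) := by
  intro H
  obtain ⟨μ, hG, hSI, hR, hL2⟩ := hex
  haveI := hG.isProbabilityMeasure
  set D := (pinnedChain (1:ℝ) 1 1 0).restDynamics (deriv_U_pinnedChain_zero 1 1 1 0) with hD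
  set m : ℝ := ∫ σ', siteE 1 1 1 0 σ' 0 ∂μ with hm
  set v : ℝ := ∫ σ, (siteE 1 1 1 0 σ 0 - m) ^ 2 ∂μ with hv
  have hvpos : 0 < v := siteE_variance_pos 1 0 1 hG hL2 m
  have hflow : ∀ (t : ℝ) (σ : ChainConfig), D.flow t σ = σ := fun _ _ => rfl
  have hS : ∀ t : ℝ, ∫ σ, (siteE 1 1 1 0 σ 0 - m) * (siteE 1 1 1 0 (D.flow t σ) 0 - m) ∂μ = v := by
    intro t
    simp only [hflow, hv]
    congr 1
    funext σ; ring
  obtain ⟨C, ν₀, hν₀, hC⟩ := H 1 1 1 0 one_pos one_pos one_pos 1 one_pos μ hG hSI hR D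
    (fun t => Eventually.of_forall fun σ => rfl) (siteE 1 1 1 0) rfl _ rfl (fun ν hν => by
      show IntegrableOn (fun t : ℝ => Real.exp (-(ν * t)) *
        ∫ σ, (siteE 1 1 1 0 σ 0 - m) * (siteE 1 1 1 0 (D.flow t σ) 0 - m) ∂μ) (Ioi 0)
      simp_rw [hS]
      have h3 : IntegrableOn (fun t : ℝ => Real.exp (-ν * t)) (Ioi 0) := exp_neg_integrableOn_Ioi 0 hν
      have h4 : IntegrableOn (fun t : ℝ => Real.exp (-ν * t) * v) (Ioi 0) := h3.mul_const v
      have h5 : (fun t : ℝ => Real.exp (-(ν * t)) * v) = fun t => Real.exp (-ν * t) * v := by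
        funext t; rw [neg_mul]
      rw [h5]; exact h4)
  refine not_halfHoelder_of_const_pos hvpos (C := C) hν₀ fun ν hν hle => ?_
  have h := hC ν hν hle
  change ν * ∫ t in Ioi (0:ℝ), Real.exp (-(ν * t)) *
      ∫ σ, (siteE 1 1 1 0 σ 0 - m) * (siteE 1 1 1 0 (D.flow t σ) 0 - m) ∂μ ≤ C * Real.sqrt ν at h
  simp_rw [hS] at h
  rwa [abelMean_const hν] at h

end Summit.AtomisticToContinuum.FouriersLaw.Theorems.LocalEnergyHalfHoelder.Negative.FalseWithoutPreservesMeasure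

end
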